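import Mathlib.Topology.Homeomorph.Lemmas
import Literature.AlgebraicGeometry.Frobenioids.ProfiniteUnitsTopologyUniqueBridge
import Literature.AlgebraicGeometry.Frobenioids.ProfiniteUnitsProofs
import HarnessLib

/-!
# Frobenioids I, Def. 2.8 (i) "[uniquely determined]" beyond the abelian case, III: the exact strength of the
# universal closure — continuity of abstract isomorphisms

Mochizuki, *The geometry of Frobenioids I*, Kyushu J. Math. **62** (2008), Definition 2.8 (i), kurims p. 52
[cite: MochizukiFrdI2008, Def. 2.8(i) p.52]: «(i) If, for every A ∈ Ob(C), it holds that O×(A) admits a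
[uniquely determined] profinite topology such that O×(A), equipped with this topology, is a topologically
finitely generated profinite [abelian] group, then we shall say that C is of unit-profinite type.»  The tree
records the bracket «[uniquely determined]» as the named statement `TfgProfiniteTopologyUnique M`
(`ProfiniteUnits.lean`, for an arbitrary group `M`: two topologically finitely generated profinite group
topologies on `M` coincide).  In the PRINTED scope — the abelian group `O×(A)` — it is PROVED
(`TfgProfiniteTopologyUnique.of_commGroup`, `TfgProfiniteAbelianTopologyUnique_holds`,
`ProfiniteUnitsProofs.lean`); for arbitrary groups it follows from the Nikolov–Segal theorem
(`TfgProfiniteTopologyUnique.of_nikolovSegalStatement`, `ProfiniteUnitsTopologyUniqueBridge.lean`, CONDITIONAL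
on the tree's named fact `Literature.GroupTheory.NikolovSegalStatement` [cite: NikolovSegal2003, Thm 1.1]).

This PROOF-ONLY file (no definitions, no signature change) decides, in the kernel, WHAT the universal closure
`∀ (M : Type u) [Group M], TfgProfiniteTopologyUnique M` of the typed schema SAYS, so that its label can be
settled without either proving Nikolov–Segal or pretending the closure is open-ended:

* `IsTfgProfinite.induced_mulEquiv` — transport of structure: if `(H, t)` is a topologically finitely generated
  profinite group and `φ : G ≃* H` is an ABSTRACT group isomorphism, then `G` with the topology induced along
  `φ` is again a topologically finitely generated profinite group;
* `TfgProfiniteTopologyUnique.continuous_mulEquiv` / `….isHomeomorph_mulEquiv` — if `TfgProfiniteTopologyUnique G`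
  holds, then EVERY abstract group isomorphism `G ≃* H` between topologically finitely generated profinite groups
  is continuous, indeed a homeomorphism (uniqueness applied to the topology of `H` transported to `G`);
* `TfgProfiniteTopologyUnique.iff_forall_continuous_id` — per group: uniqueness ⟺ the identity is continuous
  between any two such topologies;
* **`TfgProfiniteTopologyUnique.forall_iff_forall_continuous_mulEquiv`** — THE STRENGTH OF THE CLOSURE: the
  universal closure over all groups is EQUIVALENT to «every abstract isomorphism between topologically finitely
  generated profinite groups is continuous», the classical corollary of Nikolov–Segal ("topologically finitely
  generated profinite groups are rigid": the topology is recovered from the group structure);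
* `TfgProfiniteTopologyUnique.forall_of_nikolovSegalStatement` — the closure from the named fact (∀-form of the
  bridge), and `IsTfgProfinite.continuous_mulEquiv_of_nikolovSegalStatement`;
* unconditional instances of the corollary: `IsTfgProfinite.continuous_mulEquiv_of_commGroup` (abstract
  isomorphisms out of a topologically finitely generated profinite ABELIAN group — the printed `O×(A)` — are
  automatically continuous: the functoriality that the bracket «[uniquely determined]» is used for in [FrdI]) and
  `IsTfgProfinite.continuous_mulEquiv_of_finite`.

Cell abc-iut, FACT-LIST row F-1275 (`TfgProfiniteTopologyUnique`, [FrdI] Def. 2.8 (i) p.52; the one LABEL-OPEN row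
of family LF1 [FrdI/II]).  HONEST FRAMING: an equivalence pinning the strength of a statement is not a proof of
it; the general closure remains exactly as hard as the rigidity corollary of Nikolov–Segal (CFSG-dependent,
a NAMED FACT in this tree, never discharged here); refereed pre-IUT group theory; nothing in this file bears on
[IUTchIII] Cor. 3.12 or asserts anything about abc.
-/

namespace Literature.AlgebraicGeometry.Frobenioids

open _root_.Topology Filter

universe u

section Transport

variable {G : Type u} {H : Type u} [Group G] [Group H]

/-- **Transport of structure along an abstract isomorphism.**  If `(H, t_H)` is a topologically finitely
generated profinite group and `φ : G ≃* H` is a group isomorphism, then `G`, equipped with the topology induced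
along `φ`, is a topologically finitely generated profinite group (it is homeomorphic and isomorphic to `H` via `φ`;
a finite set topologically generating `H` pulls back to one topologically generating `G`).
[cite: MochizukiFrdI2008, Def. 2.8(i) p.52] -/
theorem IsTfgProfinite.induced_mulEquiv [tH : TopologicalSpace H] (hH : IsTfgProfinite H) (φ : G ≃* H) :
    @IsTfgProfinite G _ (TopologicalSpace.induced φ tH) := by
  classical
  letI tG : TopologicalSpace G := TopologicalSpace.induced φ tH
  -- `φ` is a homeomorphism for the induced topology
  let ψ : G ≃ₜ H := φ.toEquiv.toHomeomorphOfIsInducing (IsInducing.induced φ)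
  have hψ : ⇑ψ.symm = ⇑φ.symm := rfl
  haveI := hH.isTopologicalGroup
  haveI := hH.compactSpace
  haveI := hH.t2Space
  haveI := hH.totallyDisconnectedSpace
  refine ⟨topologicalGroup_induced φ.toMonoidHom, ψ.symm.compactSpace, ψ.symm.t2Space,
    ψ.symm.totallyDisconnectedSpace, ?_⟩
  obtain ⟨S, hS⟩ := hH.exists_finset_dense
  refine ⟨S.image φ.symm, ?_⟩
  have hset : ((Subgroup.closure (φ.symm '' (S : Set H)) : Subgroup G) : Set G)
      = φ.symm '' ((Subgroup.closure (S : Set H) : Subgroup H) : Set H) := by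
    rw [← MulEquiv.coe_toMonoidHom, ← MonoidHom.map_closure, Subgroup.coe_map]
  rw [Finset.coe_image, hset, ← hψ]
  exact ψ.symm.surjective.denseRange.dense_image ψ.symm.continuous hS

/-- **Uniqueness of the topology forces abstract isomorphisms to be continuous.**  If any two topologically
finitely generated profinite group topologies on the group `G` coincide (`TfgProfiniteTopologyUnique G`), then
every ABSTRACT group isomorphism `φ : G ≃* H` from a topologically finitely generated profinite group `G` to a
topologically finitely generated profinite group `H` is continuous: the topology of `H` transported to `G` along
`φ` is such a topology, hence equals the given one. [cite: MochizukiFrdI2008, Def. 2.8(i) p.52] -/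
theorem TfgProfiniteTopologyUnique.continuous_mulEquiv [tG : TopologicalSpace G] [tH : TopologicalSpace H]
    (hG : TfgProfiniteTopologyUnique G) (h₁ : IsTfgProfinite G) (h₂ : IsTfgProfinite H) (φ : G ≃* H) :
    Continuous φ := by
  have heq : tG = TopologicalSpace.induced φ tH := hG tG _ h₁ (h₂.induced_mulEquiv φ)
  rw [continuous_iff_le_induced]
  exact heq.le

/-- Under `TfgProfiniteTopologyUnique G`, every abstract group isomorphism `G ≃* H` between topologically
finitely generated profinite groups is a HOMEOMORPHISM (continuous bijection, compact source, Hausdorff target).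
[cite: MochizukiFrdI2008, Def. 2.8(i) p.52] -/
theorem TfgProfiniteTopologyUnique.isHomeomorph_mulEquiv [tG : TopologicalSpace G] [tH : TopologicalSpace H]
    (hG : TfgProfiniteTopologyUnique G) (h₁ : IsTfgProfinite G) (h₂ : IsTfgProfinite H) (φ : G ≃* H) :
    IsHomeomorph φ := by
  haveI := h₁.compactSpace
  haveI := h₂.t2Space
  exact isHomeomorph_iff_continuous_bijective.2 ⟨hG.continuous_mulEquiv h₁ h₂ φ, φ.bijective⟩

/-- In particular, under `TfgProfiniteTopologyUnique G` every abstract AUTOMORPHISM of a topologically finitely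
generated profinite group `(G, t)` is continuous. [cite: MochizukiFrdI2008, Def. 2.8(i) p.52] -/
theorem TfgProfiniteTopologyUnique.continuous_mulAut [tG : TopologicalSpace G]
    (hG : TfgProfiniteTopologyUnique G) (h₁ : IsTfgProfinite G) (φ : MulAut G) : Continuous φ :=
  hG.continuous_mulEquiv h₁ h₁ φ

end Transport

section PerGroup

variable (M : Type u) [Group M]

/-- **Per-group reformulation.**  `TfgProfiniteTopologyUnique M` holds iff the identity map of `M` is continuous
from any topologically finitely generated profinite group topology on `M` to any other (then it is continuous
both ways, so the two topologies are equal). [cite: MochizukiFrdI2008, Def. 2.8(i) p.52] -/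
theorem TfgProfiniteTopologyUnique.iff_forall_continuous_id :
    TfgProfiniteTopologyUnique M ↔
      ∀ t₁ t₂ : TopologicalSpace M, @IsTfgProfinite M _ t₁ → @IsTfgProfinite M _ t₂ →
        Continuous[t₁, t₂] (id : M → M) := by
  constructor
  · intro h t₁ t₂ h₁ h₂
    rw [continuous_id_iff_le]
    exact (h t₁ t₂ h₁ h₂).le
  · intro h t₁ t₂ h₁ h₂
    exact le_antisymm (continuous_id_iff_le.1 (h t₁ t₂ h₁ h₂)) (continuous_id_iff_le.1 (h t₂ t₁ h₂ h₁))

end PerGroup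

/-- **The strength of the universal closure of Def. 2.8 (i) "[uniquely determined]" as typed.**  The closure of
the named statement over ALL groups — `∀ M, TfgProfiniteTopologyUnique M` — is EQUIVALENT to the rigidity
statement «every abstract group isomorphism between topologically finitely generated profinite groups is
continuous» (hence a homeomorphism).  Forward: transport the topology of `H` to `G` and use uniqueness on `G`;
backward: apply continuity to the identity of `M` in both directions.  The right-hand side is the classical
corollary of the Nikolov–Segal theorem [cite: NikolovSegal2003, Thm 1.1]; this equivalence is what the label of
FACT-LIST row F-1275 rests on (the printed, abelian, scope being proved: `TfgProfiniteTopologyUnique.of_commGroup`).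
[cite: MochizukiFrdI2008, Def. 2.8(i) p.52] -/
theorem TfgProfiniteTopologyUnique.forall_iff_forall_continuous_mulEquiv :
    (∀ (M : Type u) [Group M], TfgProfiniteTopologyUnique M) ↔
      ∀ (G H : Type u) [Group G] [Group H] [TopologicalSpace G] [TopologicalSpace H],
        IsTfgProfinite G → IsTfgProfinite H → ∀ φ : G ≃* H, Continuous φ := by
  constructor
  · intro h G H _ _ _ _ hG hH φ
    exact (h G).continuous_mulEquiv hG hH φ
  · intro h M _ t₁ t₂ h₁ h₂
    have h12 : Continuous[t₁, t₂] (id : M → M) := by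
      simpa only [MulEquiv.coe_refl] using @h M M _ _ t₁ t₂ h₁ h₂ (MulEquiv.refl M)
    have h21 : Continuous[t₂, t₁] (id : M → M) := by
      simpa only [MulEquiv.coe_refl] using @h M M _ _ t₂ t₁ h₂ h₁ (MulEquiv.refl M)
    exact le_antisymm (continuous_id_iff_le.1 h12) (continuous_id_iff_le.1 h21)

/-- The same strength statement with «homeomorphism» in place of «continuous» on the right.
[cite: MochizukiFrdI2008, Def. 2.8(i) p.52] [cite: NikolovSegal2003, Thm 1.1] -/
theorem TfgProfiniteTopologyUnique.forall_iff_forall_isHomeomorph_mulEquiv :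
    (∀ (M : Type u) [Group M], TfgProfiniteTopologyUnique M) ↔
      ∀ (G H : Type u) [Group G] [Group H] [TopologicalSpace G] [TopologicalSpace H],
        IsTfgProfinite G → IsTfgProfinite H → ∀ φ : G ≃* H, IsHomeomorph φ := by
  rw [TfgProfiniteTopologyUnique.forall_iff_forall_continuous_mulEquiv]
  constructor
  · intro h G H _ _ _ _ hG hH φ
    haveI := hG.compactSpace
    haveI := hH.t2Space
    exact isHomeomorph_iff_continuous_bijective.2 ⟨h G H hG hH φ, φ.bijective⟩
  · intro h G H _ _ _ _ hG hH φ
    exact (h G H hG hH φ).continuous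

/-- **The universal closure from Nikolov–Segal** (∀-form of `TfgProfiniteTopologyUnique.of_nikolovSegalStatement`):
CONDITIONAL on the named fact `Literature.GroupTheory.NikolovSegalStatement` (recorded in the tree as a `Prop`,
not proved — a deep theorem depending on the classification of finite simple groups), the named statement of
Def. 2.8 (i) holds for every group. [cite: NikolovSegal2003, Thm 1.1] [cite: MochizukiFrdI2008, Def. 2.8(i) p.52] -/
theorem TfgProfiniteTopologyUnique.forall_of_nikolovSegalStatement
    (hNS : Literature.GroupTheory.NikolovSegalStatement.{u}) :
    ∀ (M : Type u) [Group M], TfgProfiniteTopologyUnique M :=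
  fun M _ => TfgProfiniteTopologyUnique.of_nikolovSegalStatement hNS M

/-- **Rigidity from Nikolov–Segal** (conditional): under the named fact, every abstract group isomorphism between
topologically finitely generated profinite groups is continuous. [cite: NikolovSegal2003, Thm 1.1] -/
theorem IsTfgProfinite.continuous_mulEquiv_of_nikolovSegalStatement
    (hNS : Literature.GroupTheory.NikolovSegalStatement.{u}) {G H : Type u} [Group G] [Group H]
    [TopologicalSpace G] [TopologicalSpace H] (h₁ : IsTfgProfinite G) (h₂ : IsTfgProfinite H)
    (φ : G ≃* H) : Continuous φ :=
  (TfgProfiniteTopologyUnique.of_nikolovSegalStatement hNS G).continuous_mulEquiv h₁ h₂ φ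

section Unconditional

/-- **Rigidity in the printed (abelian) scope, unconditionally.**  Every abstract group isomorphism `φ : G ≃* H`
from a topologically finitely generated profinite ABELIAN group — the `O×(A)` of Def. 2.8 (i) — to a
topologically finitely generated profinite group is continuous: the profinite topology of `O×(A)` is
«[uniquely determined]» by the group, so it is respected by every isomorphism of groups.
[cite: MochizukiFrdI2008, Def. 2.8(i) p.52] -/
theorem IsTfgProfinite.continuous_mulEquiv_of_commGroup {G H : Type u} [CommGroup G] [Group H]
    [TopologicalSpace G] [TopologicalSpace H] (h₁ : IsTfgProfinite G) (h₂ : IsTfgProfinite H)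
    (φ : G ≃* H) : Continuous φ :=
  (TfgProfiniteTopologyUnique.of_commGroup G).continuous_mulEquiv h₁ h₂ φ

/-- The abelian rigidity as a homeomorphism statement. [cite: MochizukiFrdI2008, Def. 2.8(i) p.52] -/
theorem IsTfgProfinite.isHomeomorph_mulEquiv_of_commGroup {G H : Type u} [CommGroup G] [Group H]
    [TopologicalSpace G] [TopologicalSpace H] (h₁ : IsTfgProfinite G) (h₂ : IsTfgProfinite H)
    (φ : G ≃* H) : IsHomeomorph φ :=
  (TfgProfiniteTopologyUnique.of_commGroup G).isHomeomorph_mulEquiv h₁ h₂ φ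

/-- Rigidity for FINITE groups, unconditionally (instance family `TfgProfiniteTopologyUnique.of_finite`).
[cite: MochizukiFrdI2008, Def. 2.8(i) p.52] -/
theorem IsTfgProfinite.continuous_mulEquiv_of_finite {G H : Type u} [Group G] [Finite G] [Group H]
    [TopologicalSpace G] [TopologicalSpace H] (h₁ : IsTfgProfinite G) (h₂ : IsTfgProfinite H)
    (φ : G ≃* H) : Continuous φ :=
  (TfgProfiniteTopologyUnique.of_finite G).continuous_mulEquiv h₁ h₂ φ

end Unconditional

end Literature.AlgebraicGeometry.Frobenioids
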